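import Literature.NumberTheory.Transcendental.PadicCW77KStep
import Literature.NumberTheory.Transcendental.CijsouwWaldschmidt1977Steps
import HarnessLib

/-!
# The `p`-adic Cijsouw–Waldschmidt descent: the invariant, the inner chain, the composition

Support file (definitions and proved theorems; no named fact), sequel to `PadicCW77KStep.lean`
(cell `abc-stewartyu`, WP-A5: the twin of the tree's `Waldschmidt1980Main.lean`). It fixes the
INTERFACES of the remaining work packages as explicit hypotheses and proves the composition:

* `Inv` — the induction invariant at level `J` (twin of `CW77.Setup.Inv` on the sign-free set-up:
  integers `p(u)` supported in the frame's box of level `J`, not all zero, bounded by `P`, with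
  `coreSum_{J,τ}(s) = 0` for odd `s < 2ᴶ S₀`, `|τ| < T/2ᴶ`);
* `kchain` — **PROVED**: the inner chain of `d` extrapolation steps at level `J` (each one is
  `padic_kstep`), from the invariant to the vanishing for odd `s < 2^{k+J} S₀`,
  `|τ| < T/2ᴶ − k t_J`, `k ≤ d`, given the archimedean denominators/sizes of the cores
  (`KSizes`, from the heights — WP-A4) and the numerical inequalities (`KFinal` — WP-A4);
* `HalfStep` (WP-A3, p3: smallness at the half-integers — `norm_Φ_le_of_zeros` — plus the
  multiquadratic Liouville inequality and the descent algebra give the invariant at level `J+1`),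
  `Siegel` (level `0`), `Endgame` (the contradiction at level `J₀`) — stated as `Prop`s;
* `inv_all`, `main` — **PROVED compositions**: `Siegel ∧ (∀ J, KSizes ∧ KFinal ∧ HalfStep) ∧ Endgame`
  and `‖Λ₀‖_p ≤ p⁻¹` give `False`; i.e. the lower bound for `‖Λ‖_p` follows once WP-A3/WP-A4
  discharge the named hypotheses for a concrete parameter choice.

## References
* [Yu1990] K. Yu, *Linear forms in p-adic logarithms II*, Compositio Math. 74 (1990), §§3–4.
* [Waldschmidt1980] M. Waldschmidt, Acta Arith. 37 (1980), §§3.4–3.5 (Lemmas 3.6, 3.7, p. 272–274).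
-/

noncomputable section

open NormedSpace Finset IsUltrametricDist
open scoped Nat

namespace Literature.NumberTheory.Transcendental

namespace PadicCW77

open CW77.Setup (Idx Tau tauNorm)

namespace Setup

variable (S : Setup) {h Lb : ℕ}

/-! ### The invariant -/

/-- **The induction invariant of the descent at level `J`** (twin of `CW77.Setup.Inv`): integers
`p(u)`, supported in the box of level `J` of the frame, not all zero, bounded by `P`, with the
relations `coreSum_{J,τ}(s) = 0` for all odd `s < 2ᴶ S₀` and `|τ| < T/2ᴶ`.
[cite: CijsouwWaldschmidt1977, §4 Step 2 (p. 186)] [cite: Waldschmidt1980, §3.4 (p. 270)] -/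
structure Inv (J₀ : ℕ) (L : Fin S.d → ℕ) (Lθ S₀ T : ℕ) (P : ℤ) (J : ℕ) (p : Idx S.d h Lb → ℤ) :
    Prop where
  /-- support in the box of level `J` -/
  supp : ∀ u, p u ≠ 0 → u ∈ S.frame.box (h := h) (Lb := Lb) L Lθ J
  /-- not all zero -/
  nonzero : ∃ u, p u ≠ 0
  /-- the size bound -/
  bound : ∀ u, |p u| ≤ P
  /-- the relations -/
  rel : ∀ s, s < 2 ^ J * S₀ → Odd s → ∀ τ : Tau S.d, tauNorm τ < T / 2 ^ J →
    S.coreSum J₀ J (S.frame.box (h := h) (Lb := Lb) L Lθ J) p τ s = 0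

/-! ### The inputs of the inner chain at level `J` (WP-A4) -/

/-- **Archimedean sizes of the cores at level `J`** (WP-A4, from the heights as in the tree's
`Waldschmidt1980Sizes*`): for the `k`-th step (`k < d`), every `|τ| + t ≤ T/2ᴶ − k t` and odd
`s₁ < 2^{k+1+J} S₀`, a denominator `0 < D ≤ Dmax k` with `D · coreSum ∈ ℤ` and `|coreSum| ≤ Mmax k`.
[cite: Waldschmidt1980, §3.3 (3.19)–(3.21) (p. 269)] -/
def KSizes (J₀ J : ℕ) (L : Fin S.d → ℕ) (Lθ S₀ T t : ℕ) (p : Idx S.d h Lb → ℤ)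
    (Dmax Mmax : ℕ → ℝ) : Prop :=
  ∀ k, k < S.d → ∀ τ : Tau S.d, tauNorm τ + t ≤ T / 2 ^ J - k * t →
    ∀ s₁, s₁ < 4 * (2 ^ (k + J) * S₀ / 2) → Odd s₁ →
      ∃ D : ℕ, 0 < D ∧ (D : ℝ) ≤ Dmax k ∧
        (∃ m : ℤ, (D : ℚ) * S.coreSum J₀ J (S.frame.box (h := h) (Lb := Lb) L Lθ J) p τ s₁ = m) ∧
        |(S.coreSum J₀ J (S.frame.box (h := h) (Lb := Lb) L Lθ J) p τ s₁ : ℝ)| ≤ Mmax k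

/-- **The numerical inequality of the `k`-th step at level `J`** (WP-A4, twin of
`W80Par.final_kstep`): with `kpts = 2^{k+J} S₀ / 2` nodes of multiplicity `t`,
`max (p^{⌊hLb/(p−1)⌋} ‖Λ₀‖ p^{⌊(t−1)/(p−1)⌋} p^{condExp p kpts t}) (p^{hLb}/(√p)^{kpts t}) < 1/(Dmax k · Mmax k)`
(first branch: `p`-bounded exponents only — F-p1-2).
[cite: Waldschmidt1980, Lemma 3.6 (p. 272)] -/
def KFinal (J : ℕ) (S₀ t : ℕ) (Dmax Mmax : ℕ → ℝ) : Prop :=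
  ∀ k, k < S.d →
    max ((S.p : ℝ) ^ (h * Lb / (S.p - 1)) * ‖S.Λ₀‖ * (S.p : ℝ) ^ ((t - 1) / (S.p - 1)) *
          (S.p : ℝ) ^ condExp S.p (2 ^ (k + J) * S₀ / 2) t)
        ((S.p : ℝ) ^ (h * Lb) / Real.sqrt S.p ^ ((2 ^ (k + J) * S₀ / 2) * t)) <
      1 / (Dmax k * Mmax k)

/-! ### The inner chain (Lemma 3.6), proved -/

/-- **The inner chain at level `J`** (twin of `W80Hyp.kchain`): from the invariant at level `J`,
for every `k ≤ d`, `coreSum_{J,τ}(s) = 0` for odd `s < 2^{k+J} S₀` and `|τ| < T/2ᴶ − k t`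
(`S₀` even, `t ≥ 1`, `(d+1) t ≤ T/2ᴶ`), by `k` applications of `padic_kstep`.
[cite: Waldschmidt1980, Lemma 3.6 (p. 272)] [cite: Yu1990, §3] -/
theorem kchain {J₀ J : ℕ} {L : Fin S.d → ℕ} {Lθ S₀ T t : ℕ} {P : ℤ} {p : Idx S.d h Lb → ℤ}
    (inv : S.Inv J₀ L Lθ S₀ T P J p) (hS₀ : Even S₀) (ht : 1 ≤ t)
    (htT : (S.d + 1) * t ≤ T / 2 ^ J) (hΛ : ‖S.Λ₀‖ ≤ (S.p : ℝ)⁻¹)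
    {Dmax Mmax : ℕ → ℝ} (hsz : S.KSizes J₀ J L Lθ S₀ T t p Dmax Mmax)
    (hfin : S.KFinal (h := h) (Lb := Lb) J S₀ t Dmax Mmax) :
    ∀ k, k ≤ S.d → ∀ s, s < 2 ^ (k + J) * S₀ → Odd s → ∀ τ : Tau S.d,
      tauNorm τ < T / 2 ^ J - k * t →
      S.coreSum J₀ J (S.frame.box (h := h) (Lb := Lb) L Lθ J) p τ s = 0 := by
  intro k
  induction k with
  | zero =>
    intro _ s hs hodd τ hτ
    rw [zero_add] at hs
    exact inv.rel s hs hodd τ (by simpa using hτ)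
  | succ k ih =>
    intro hk s hs hodd τ hτ
    have hk' : k < S.d := by omega
    have hzero := ih hk'.le
    obtain ⟨r, hr⟩ := hS₀
    -- `kpts = 2^{k+J} S₀ / 2 = 2^{k+J} r`
    set kpts : ℕ := 2 ^ (k + J) * S₀ / 2 with hkpts
    have hkpts_eq : kpts = 2 ^ (k + J) * r := by
      rw [hkpts, hr, show 2 ^ (k + J) * (r + r) = 2 ^ (k + J) * r * 2 by ring, Nat.mul_div_cancel _ two_pos]
    have h2k : 2 * kpts = 2 ^ (k + J) * S₀ := by rw [hkpts_eq, hr]; ring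
    have h4k : 4 * kpts = 2 ^ (k + 1 + J) * S₀ := by
      rw [hkpts_eq, hr, show k + 1 + J = (k + J) + 1 by ring, pow_succ]; ring
    -- the zeros at the `kpts` odd nodes `2i+1 < 2 kpts`
    have hzero' : ∀ i < kpts, ∀ τ'' : Tau S.d, tauNorm τ'' < T / 2 ^ J - k * t →
        S.coreSum J₀ J (S.frame.box (h := h) (Lb := Lb) L Lθ J) p τ'' (2 * i + 1) = 0 := by
      intro i hi τ'' hτ''
      exact hzero (2 * i + 1) (by rw [← h2k]; omega) ⟨i, by ring⟩ τ'' hτ''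
    have key := S.padic_kstep J₀ J (S.frame.box (h := h) (Lb := Lb) L Lθ J) p (kpts := kpts)
      (Tlo := T / 2 ^ J - k * t) (t := t) ht hzero' hΛ
      (Dmax := Dmax k) (Mmax := Mmax k) (hsz k hk') (hfin k hk')
    refine key s (by rw [h4k]; exact hs) hodd τ ?_
    -- `|τ| < T/2^J − (k+1) t ⇒ |τ| + t ≤ T/2^J − k t`
    have h2 : (k + 1) * t ≤ T / 2 ^ J :=
      le_trans (Nat.mul_le_mul_right _ (by omega)) htT
    rw [Nat.succ_mul] at hτ
    omega

/-! ### The inputs of the outer induction (WP-A3, WP-A4) and the composition -/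

/-- **The half step with the descent algebra at level `J`** (WP-A3, p3: twin of
`w80_halfstep_far` + `CW77.Setup.descent_algebra`): from the invariant at level `J` with integer
bound `P` and the vanishing delivered by the inner chain (odd `s < 2^{d+J} S₀`, `|τ| < T/2ᴶ − d t`),
the invariant at level `J + 1` with the same bound. Its proof: `norm_Φ_le_of_zeros` at the
half-integers `s/2`, `exp_ψ_half_natCast`, the multiquadratic Liouville inequality
(`Multiquad.norm_evL_ge`) forcing the class sums to vanish, and the re-indexing `λ = λ⁰ + 2μ`.
[cite: Waldschmidt1980, Lemma 3.7 (pp. 272–273)] [cite: CijsouwWaldschmidt1977, §4 Step 2 (pp. 189–191)] -/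
def HalfStep (J₀ J : ℕ) (L : Fin S.d → ℕ) (Lθ S₀ T t : ℕ) (P : ℤ) : Prop :=
  ∀ p : Idx S.d h Lb → ℤ, S.Inv J₀ L Lθ S₀ T P J p →
    (∀ s, s < 2 ^ (S.d + J) * S₀ → Odd s → ∀ τ : Tau S.d, tauNorm τ < T / 2 ^ J - S.d * t →
      S.coreSum J₀ J (S.frame.box (h := h) (Lb := Lb) L Lθ J) p τ s = 0) →
    ∃ p' : Idx S.d h Lb → ℤ, S.Inv J₀ L Lθ S₀ T P (J + 1) p'

/-- **Level `0`: Siegel's lemma** (twin of `CW77.Setup.siegel_step` on the sign-free cores; the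
count `#box₀ ≥ 2 #equations` and the integer bound `P` are WP-A4's).
[cite: Waldschmidt1980, Lemma 3.2 (pp. 266–267)] -/
def Siegel (J₀ : ℕ) (L : Fin S.d → ℕ) (Lθ S₀ T : ℕ) (P : ℤ) : Prop :=
  ∃ p : Idx S.d h Lb → ℤ, S.Inv J₀ L Lθ S₀ T P 0 p

/-- **The contradiction at the top level `J₀`** (twin of `w80_endgame`: `L_θ < 2^{J₀}`, the
Vandermonde argument in the `τⱼ` and the zero count of the `Δ`-polynomials).
[cite: Waldschmidt1980, §3.5 (p. 274)] -/
def Endgame (J₀ : ℕ) (L : Fin S.d → ℕ) (Lθ S₀ T : ℕ) (P : ℤ) : Prop :=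
  ∀ p : Idx S.d h Lb → ℤ, S.Inv J₀ L Lθ S₀ T P J₀ p → False

/-- **The invariant passes from `J` to `J + 1`** (twin of `W80Hyp.inv_succ`): inner chain, then
the half step. [cite: Waldschmidt1980, Lemmas 3.6–3.7 (pp. 272–273)] -/
theorem inv_succ {J₀ J : ℕ} {L : Fin S.d → ℕ} {Lθ S₀ T : ℕ} {P : ℤ} {t : ℕ → ℕ}
    (hS₀ : Even S₀) (ht : 1 ≤ t J) (htT : (S.d + 1) * t J ≤ T / 2 ^ J)
    (hΛ : ‖S.Λ₀‖ ≤ (S.p : ℝ)⁻¹) {Dmax Mmax : ℕ → ℕ → ℝ}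
    (hsz : ∀ p : Idx S.d h Lb → ℤ, S.Inv J₀ L Lθ S₀ T P J p →
      S.KSizes J₀ J L Lθ S₀ T (t J) p (Dmax J) (Mmax J))
    (hfin : S.KFinal (h := h) (Lb := Lb) J S₀ (t J) (Dmax J) (Mmax J))
    (hhalf : S.HalfStep (h := h) (Lb := Lb) J₀ J L Lθ S₀ T (t J) P)
    {p : Idx S.d h Lb → ℤ} (inv : S.Inv J₀ L Lθ S₀ T P J p) :
    ∃ p' : Idx S.d h Lb → ℤ, S.Inv J₀ L Lθ S₀ T P (J + 1) p' :=
  hhalf p inv (S.kchain inv hS₀ ht htT hΛ (hsz p inv) hfin S.d le_rfl)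

/-- **The invariant at every level `J ≤ J₀`** (twin of `W80Hyp.inv_all`).
[cite: Waldschmidt1980, §3.4–3.5 (pp. 270–274)] -/
theorem inv_all {J₀ : ℕ} {L : Fin S.d → ℕ} {Lθ S₀ T : ℕ} {P : ℤ} {t : ℕ → ℕ}
    (hS₀ : Even S₀) (ht : ∀ J, J < J₀ → 1 ≤ t J)
    (htT : ∀ J, J < J₀ → (S.d + 1) * t J ≤ T / 2 ^ J)
    (hΛ : ‖S.Λ₀‖ ≤ (S.p : ℝ)⁻¹) {Dmax Mmax : ℕ → ℕ → ℝ}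
    (hsz : ∀ J, J < J₀ → ∀ p : Idx S.d h Lb → ℤ, S.Inv J₀ L Lθ S₀ T P J p →
      S.KSizes J₀ J L Lθ S₀ T (t J) p (Dmax J) (Mmax J))
    (hfin : ∀ J, J < J₀ → S.KFinal (h := h) (Lb := Lb) J S₀ (t J) (Dmax J) (Mmax J))
    (hhalf : ∀ J, J < J₀ → S.HalfStep (h := h) (Lb := Lb) J₀ J L Lθ S₀ T (t J) P)
    (hsiegel : S.Siegel (h := h) (Lb := Lb) J₀ L Lθ S₀ T P) :
    ∀ J, J ≤ J₀ → ∃ p : Idx S.d h Lb → ℤ, S.Inv J₀ L Lθ S₀ T P J p := by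
  intro J
  induction J with
  | zero => intro _; exact hsiegel
  | succ J ih =>
    intro hJ
    obtain ⟨p, inv⟩ := ih (by omega)
    have hJ' : J < J₀ := by omega
    exact S.inv_succ hS₀ (ht J hJ') (htT J hJ') hΛ (hsz J hJ') (hfin J hJ') (hhalf J hJ') inv

/-- **The `p`-adic machine** (twin of `W80Hyp.main`): if Siegel's lemma starts the descent, the
sizes and the numerical inequalities of every inner step hold, the half steps pass the invariant up,
and the top level is contradictory, then the smallness hypothesis `‖Λ₀‖_p ≤ p⁻¹` (under which all the
numerical inequalities were derived from `‖Λ‖_p ≤ p^{-U/log p}`) is absurd. WP-A4 instantiates the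
parameters; the conclusion is then `ord_p(Θ − 1) · log p < U`.
[cite: Waldschmidt1980, Prop. 3.8 and §3.5 (pp. 263, 274)] [cite: Yu1990, Theorem 1] -/
theorem main {J₀ : ℕ} {L : Fin S.d → ℕ} {Lθ S₀ T : ℕ} {P : ℤ} {t : ℕ → ℕ}
    (hS₀ : Even S₀) (ht : ∀ J, J < J₀ → 1 ≤ t J)
    (htT : ∀ J, J < J₀ → (S.d + 1) * t J ≤ T / 2 ^ J)
    (hΛ : ‖S.Λ₀‖ ≤ (S.p : ℝ)⁻¹) {Dmax Mmax : ℕ → ℕ → ℝ}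
    (hsz : ∀ J, J < J₀ → ∀ p : Idx S.d h Lb → ℤ, S.Inv J₀ L Lθ S₀ T P J p →
      S.KSizes J₀ J L Lθ S₀ T (t J) p (Dmax J) (Mmax J))
    (hfin : ∀ J, J < J₀ → S.KFinal (h := h) (Lb := Lb) J S₀ (t J) (Dmax J) (Mmax J))
    (hhalf : ∀ J, J < J₀ → S.HalfStep (h := h) (Lb := Lb) J₀ J L Lθ S₀ T (t J) P)
    (hsiegel : S.Siegel (h := h) (Lb := Lb) J₀ L Lθ S₀ T P)
    (hend : S.Endgame (h := h) (Lb := Lb) J₀ L Lθ S₀ T P) : False := by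
  obtain ⟨p, inv⟩ := S.inv_all hS₀ ht htT hΛ hsz hfin hhalf hsiegel J₀ le_rfl
  exact hend p inv

end Setup

end PadicCW77

end Literature.NumberTheory.Transcendental

end
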